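import Summits.QuantumFields.YangMills.Theorems.AtomicCalibrationRLevelConstants
import Summits.QuantumFields.YangMills.Theorems.AtomicCalibrationRWhitneySeparation
import Summits.QuantumFields.YangMills.Theorems.AtomicCalibrationRPairCutoffProduct
import Summits.QuantumFields.YangMills.Theorems.AtomicCalibrationRTelescopingAssembly

/-!
# AtomicCalibrationR (stmt-QuantumFields-28169), E2 `stub_offDiagonalWhitney` — the pieces of construction (T): smoothness, support, separation, assembly
# (roadmap v2 item B.4, per-piece clauses (ii)(iii)(iv)(vii) of `WhitneyPkg`; prover w4 g23, free hands)

The pieces of construction (T) at separation ratio `Λ ≥ 1` are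
`P_{k,c} = G · tele(pairCut n · ) k · gridBump φ n h_k c` (`G ∈ {Re F, Im F}`, `c : Fin n × Fin 4 → ℤ`, mesh `h_k = 2^{−k}/(8(Λ+1))`,
radius `ρ_k = 2h_k`; `tele χ 0 = χ 0` the far cut-off, `tele χ (k+1) = χ (k+1) − χ k` the band cut-offs).  This file proves the
clauses of `WhitneyPkg` that hold piece by piece:

* `contDiff_tele_pairCut`, `contDiff_piece`, `hasCompactSupport_piece` — the pieces are `C^∞` with compact support (so they are Schwartz);
* `tsupport_piece_subset` — clause (iii): the support sits in the cube of radius `2h` around `gridCentre`;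
* `le_norm_sub_of_tele_ne_zero` — where the cut-off of level `k` is alive all slot pairs are `≥ 2^{−k}` apart;
  `exists_coord_sep_of_alive` — clause (iv) for ALIVE pieces (`4(Λ+1)h_k ≤ 2^{−k}`, `WhitneySeparation.exists_coord_sep_gridCentre`);
  `exists_coord_sep_dummy` — clause (iv) for the dummy centres `(2Λρ·l)_{l}` given to dead pieces; `piece_eq_zero_of_not_alive`;
* `hasSum_pieces` — clause (vii) at a point: `Σ_{(k,c)} P_{k,c}(z) = G(z)` whenever `G` vanishes on the coincidence locus
  (`TelescopingAssembly.hasSum_telescope_mul_partition` with the exact grid partition and the stabilising cut-offs).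

No definitions; no stub/crux/rung/summit is closed; nothing here touches Yang–Mills; the YM mass gap is NOT proved. [folklore]
-/

set_option autoImplicit false

noncomputable section

open scoped BigOperators ContDiff
open Set Filter
open Summit.QuantumFields.YangMills.Cruxes.AtomicCalibrationR.PairCutoff (pairCut contDiff_pairCut eventually_pairCut_eq_one
  pairCut_eq_zero_of_mem_locus)
open Summit.QuantumFields.YangMills.Cruxes.AtomicCalibrationR.PairCutoffProduct (pairCut_succ_sub_ne_zero
  one_lt_of_pairCut_zero_ne_zero)
open Summit.QuantumFields.YangMills.Cruxes.AtomicCalibrationR.GridPartition (gridBump gridCentre gridCentre_apply gridBox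
  contDiff_gridBump gridBump_eq_zero_of_not_mem_gridBox sum_gridBox_gridBump_eq_one hasCompactSupport_gridBump
  tsupport_gridBump_subset)
open Summit.QuantumFields.YangMills.Cruxes.AtomicCalibrationR.TelescopingAssembly (tele hasSum_telescope_mul_partition
  hasSum_telescope_mul_partition_of_eq_zero)
open Summit.QuantumFields.YangMills.Cruxes.AtomicCalibrationR.WhitneySeparation (exists_coord_sep_gridCentre)
open Summit.QuantumFields.YangMills.Cruxes.AtomicCalibrationR.LevelConstants (mesh_pos sep_mesh)

namespace Summit.QuantumFields.YangMills.Cruxes.AtomicCalibrationR.WhitneyPieces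

variable {n : ℕ}

/-! ## Smoothness and support -/

/-- The telescoped cut-off of level `k` is `C^∞`. -/
theorem contDiff_tele_pairCut (n k : ℕ) :
    ContDiff ℝ ∞ (fun w : Fin n → EuclideanSpace ℝ (Fin 4) => tele (fun j => pairCut n j w) k) := by
  cases k with
  | zero => exact contDiff_pairCut n 0
  | succ k => exact (contDiff_pairCut n (k + 1)).sub (contDiff_pairCut n k)

/-- The pieces are `C^∞`. -/
theorem contDiff_piece {G : (Fin n → EuclideanSpace ℝ (Fin 4)) → ℝ} (hG : ContDiff ℝ ∞ G) {φ : ℝ → ℝ} (hφ : ContDiff ℝ ∞ φ)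
    (k : ℕ) (h : ℝ) (c : Fin n × Fin 4 → ℤ) :
    ContDiff ℝ ∞ (fun w => G w * (tele (fun j => pairCut n j w) k * gridBump φ n h c w)) :=
  hG.mul ((contDiff_tele_pairCut n k).mul (contDiff_gridBump hφ n h c))

/-- The pieces have compact support. -/
theorem hasCompactSupport_piece (G : (Fin n → EuclideanSpace ℝ (Fin 4)) → ℝ) {φ : ℝ → ℝ} (hφs : tsupport φ ⊆ Icc (-1 : ℝ) 1)
    (k : ℕ) {h : ℝ} (hh : 0 < h) (c : Fin n × Fin 4 → ℤ) :
    HasCompactSupport (fun w => G w * (tele (fun j => pairCut n j w) k * gridBump φ n h c w)) :=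
  ((hasCompactSupport_gridBump hφs n hh c).mul_left (f := fun w => tele (fun j => pairCut n j w) k)).mul_left

/-- **Clause (iii)**: the support of a piece sits in the cube of radius `2h` around its grid centre. -/
theorem tsupport_piece_subset (G : (Fin n → EuclideanSpace ℝ (Fin 4)) → ℝ) {φ : ℝ → ℝ} (hφs : tsupport φ ⊆ Icc (-1 : ℝ) 1)
    (k : ℕ) {h : ℝ} (hh : 0 < h) (c : Fin n × Fin 4 → ℤ) :
    tsupport (fun w => G w * (tele (fun j => pairCut n j w) k * gridBump φ n h c w)) ⊆
      {z | ∀ l, ‖z l - gridCentre n h c l‖ ≤ 2 * h} :=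
  ((tsupport_mul_subset_right (f := G) (g := fun w => tele (fun j => pairCut n j w) k * gridBump φ n h c w)).trans
    (tsupport_mul_subset_right (f := fun w => tele (fun j => pairCut n j w) k) (g := gridBump φ n h c))).trans
    (tsupport_gridBump_subset hφs n hh c)

/-- A dead piece (its bump part vanishes identically) is the zero function. -/
theorem piece_eq_zero_of_not_alive (G : (Fin n → EuclideanSpace ℝ (Fin 4)) → ℝ) (φ : ℝ → ℝ) (k : ℕ) (h : ℝ)
    (c : Fin n × Fin 4 → ℤ) (hdead : ¬ ∃ z, tele (fun j => pairCut n j z) k * gridBump φ n h c z ≠ 0) :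
    (fun w => G w * (tele (fun j => pairCut n j w) k * gridBump φ n h c w)) = fun _ => 0 := by
  push Not at hdead
  funext w
  rw [hdead w, mul_zero]

/-! ## Separation (clause (iv)) -/

/-- Where the cut-off of level `k` is alive, all slot pairs are at least `2^{-k}` apart. -/
theorem le_norm_sub_of_tele_ne_zero {k : ℕ} {z : Fin n → EuclideanSpace ℝ (Fin 4)} (hz : tele (fun j => pairCut n j z) k ≠ 0)
    {l l' : Fin n} (hll' : l ≠ l') : (2 : ℝ)⁻¹ ^ k ≤ ‖z l - z l'‖ := by
  cases k with
  | zero =>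
    rw [pow_zero]
    exact (one_lt_of_pairCut_zero_ne_zero hz hll').le
  | succ k => exact ((pairCut_succ_sub_ne_zero hz).1 l l' hll').le

/-- **Clause (iv) for alive pieces**: if the bump part of the piece `(k, c)` is alive somewhere, its slot centres are pairwise
`Λ · ρ_k`-separated in some coordinate (`ρ_k = 2 h_k`, `h_k = 2^{-k}/(8(Λ+1))`). -/
theorem exists_coord_sep_of_alive {Λ : ℝ} (hΛ : 1 ≤ Λ) {φ : ℝ → ℝ} (hφs : tsupport φ ⊆ Icc (-1 : ℝ) 1) {k : ℕ}
    {c : Fin n × Fin 4 → ℤ}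
    (halive : ∃ z, tele (fun j => pairCut n j z) k * gridBump φ n ((2 : ℝ)⁻¹ ^ k / (8 * (Λ + 1))) c z ≠ 0)
    {l l' : Fin n} (hll' : l ≠ l') :
    ∃ i : Fin 4, Λ * (2 * ((2 : ℝ)⁻¹ ^ k / (8 * (Λ + 1)))) ≤
      |gridCentre n ((2 : ℝ)⁻¹ ^ k / (8 * (Λ + 1))) c l i - gridCentre n ((2 : ℝ)⁻¹ ^ k / (8 * (Λ + 1))) c l' i| := by
  obtain ⟨z, hz⟩ := halive
  have ht : tele (fun j => pairCut n j z) k ≠ 0 := left_ne_zero_of_mul hz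
  have hg : gridBump φ n ((2 : ℝ)⁻¹ ^ k / (8 * (Λ + 1))) c z ≠ 0 := right_ne_zero_of_mul hz
  exact exists_coord_sep_gridCentre hφs (mesh_pos hΛ k) hg (fun m m' hmm' => le_norm_sub_of_tele_ne_zero ht hmm')
    (sep_mesh hΛ k) hll'

/-- **Clause (iv) for dead pieces**: the dummy centres `l ↦ (2Λρ · l, …)` are pairwise `Λρ`-separated in the first coordinate. -/
theorem exists_coord_sep_dummy (n : ℕ) {Λ ρ : ℝ} (hΛ : 0 ≤ Λ) (hρ : 0 ≤ ρ) {l l' : Fin n} (hll' : l ≠ l') :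
    ∃ i : Fin 4, Λ * ρ ≤ |gridCentre n (2 * Λ * ρ) (fun q => ((q.1 : ℕ) : ℤ)) l i -
      gridCentre n (2 * Λ * ρ) (fun q => ((q.1 : ℕ) : ℤ)) l' i| := by
  refine ⟨0, ?_⟩
  rw [gridCentre_apply, gridCentre_apply, ← mul_sub, abs_mul, abs_of_nonneg (by positivity : (0 : ℝ) ≤ 2 * Λ * ρ)]
  have hne : ((l : ℕ) : ℤ) ≠ ((l' : ℕ) : ℤ) := by
    intro h
    exact hll' (Fin.ext (by exact_mod_cast h))
  have h1 : (1 : ℝ) ≤ |((((l : ℕ) : ℤ) : ℝ)) - ((((l' : ℕ) : ℤ) : ℝ))| := by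
    rw [← Int.cast_sub, ← Int.cast_abs]
    exact_mod_cast Int.one_le_abs (sub_ne_zero.2 hne)
  have h0 : 0 ≤ Λ * ρ := mul_nonneg hΛ hρ
  calc Λ * ρ = Λ * ρ * 1 := (mul_one _).symm
    _ ≤ 2 * Λ * ρ * |((((l : ℕ) : ℤ) : ℝ)) - ((((l' : ℕ) : ℤ) : ℝ))| := by nlinarith

/-! ## Assembly at a point (clause (vii)) -/

/-- **Clause (vii) at a point.**  For any `G` vanishing on the coincidence locus (e.g. `Re F`, `Im F` for `F ∈ ⁰𝒮`) and any meshes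
`h k`, the pieces of all levels and all cubes sum to `G` pointwise. -/
theorem hasSum_pieces {φ : ℝ → ℝ} (hφs : tsupport φ ⊆ Icc (-1 : ℝ) 1) (hφ1 : ∀ t, ∑' c : ℤ, φ (t - c) = 1) (h : ℕ → ℝ)
    (G : (Fin n → EuclideanSpace ℝ (Fin 4)) → ℝ) (z : Fin n → EuclideanSpace ℝ (Fin 4))
    (hG : (∃ l l' : Fin n, l ≠ l' ∧ z l = z l') → G z = 0) :
    HasSum (fun p : ℕ × (Fin n × Fin 4 → ℤ) => G z * (tele (fun j => pairCut n j z) p.1 * gridBump φ n (h p.1) p.2 z))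
      (G z) := by
  classical
  have hassoc : ∀ p : ℕ × (Fin n × Fin 4 → ℤ), G z * (tele (fun j => pairCut n j z) p.1 * gridBump φ n (h p.1) p.2 z) =
      G z * tele (fun j => pairCut n j z) p.1 * gridBump φ n (h p.1) p.2 z := fun p => (mul_assoc _ _ _).symm
  by_cases hloc : ∃ l l' : Fin n, l ≠ l' ∧ z l = z l'
  · exact (hasSum_telescope_mul_partition_of_eq_zero (G z) (hG hloc) (fun j => pairCut n j z)
      (fun k c => gridBump φ n (h k) c z)).congr_fun hassoc
  · push Not at hloc
    obtain ⟨k₀, hk₀⟩ := eventually_atTop.1 (eventually_pairCut_eq_one (z := z) fun l l' hll' => hloc l l' hll')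
    exact (hasSum_telescope_mul_partition (G z) (fun j => pairCut n j z) hk₀ (fun k c => gridBump φ n (h k) c z)
      (fun k => gridBox n (h k) z) (fun k c hc => gridBump_eq_zero_of_not_mem_gridBox hφs n (h k) hc)
      (fun k => sum_gridBox_gridBump_eq_one hφs hφ1 n (h k) z)).congr_fun hassoc

end Summit.QuantumFields.YangMills.Cruxes.AtomicCalibrationR.WhitneyPieces

end
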